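import Literature.NumberTheory.GaloisRepresentations.GaloisRep
import Literature.NumberTheory.GaloisRepresentations.FramedRepDualProofs
import Literature.NumberTheory.GaloisRepresentations.FramedRepEquivConj
import HarnessLib

/-!
# Even framed Galois representations

The parity predicate dual to `Literature.NumberTheory.GaloisRepresentations.FramedGaloisRep.IsOdd`
(`GaloisRep.lean`): a framed Galois representation `ρ : Γ_K → GL_n(A)` is **even** (totally even)
if `det ρ(c) = 1` for every complex conjugation `c ∈ Γ_K` attached to every real embedding
`φ : K →+* ℝ` (`Literature.NumberTheory.GaloisRepresentations.IsComplexConjugation φ c`).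

## Main definitions and results

* `FramedGaloisRep.IsEven ρ` — the predicate, literally the inline hypothesis
  `∀ φ c, IsComplexConjugation φ c → Matrix.GeneralLinearGroup.det (ρ c) = 1` used by the
  even-Artin routes, so that restating those items over the definition is definitional
  (`FramedGaloisRep.isEven_iff`, `Iff.rfl`).
* `FramedGaloisRep.isEven_one` (the trivial representation is even), `isEven_of_isEmpty`
  (vacuous without real embeddings, as for `IsOdd`), `IsEven.not_isOdd` (even and odd are
  exclusive as soon as `K` has a real embedding and `2 ≠ 0` in `A`),
  `det_sq_eq_one_of_isComplexConjugation` (`det ρ(c)² = 1` always).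
* Invariance: `IsEven.dual`, `isEven_conj_iff`, `isEven_of_equiv`.
* Rank two: `FramedGaloisRep.isEven_iff_eq_one_or_eq_neg_one` — over an integral domain with
  `2 ≠ 0`, a rank-2 representation is even iff every complex conjugation acts by the scalar `±1`
  (the only involutions of `SL₂` are `±1`, `Matrix.eq_one_or_eq_neg_one_of_mul_self_of_det`
  below); in particular an even `ρ : Γ_ℚ → GL₂(ℂ)` has `ρ(c)` central, which is how the parity
  enters the Γ-factor `Γ_ℝ(s+a)²`, `a ∈ {0,1}`, of Booker (2003), p. 1090.

## References

* J.-P. Serre, *Sur les représentations modulaires de degré 2 de Gal(ℚ̄/ℚ)*, Duke Math. J. 54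
  (1987), §1.1 (parity of `ρ` via `det ρ(c)`).
* A. Booker, *Poles of Artin L-functions and the strong Artin conjecture*, Ann. of Math. 158
  (2003), p. 1090: "ρ is even (meaning det(ρ)(c) = 1, where c denotes complex conjugation), …
  odd (det(ρ)(c) = −1)".

Mathlib has no parity predicate for Galois representations (grep `IsEven`, `IsOdd` under
`Mathlib/NumberTheory`, `Mathlib/RepresentationTheory`: only parity of integers / functions /
Dirichlet characters `DirichletCharacter.Even`), and `DirichletCharacter.Even` (`χ(-1) = 1`) is the
`GL₁`-shadow of this notion, not reused here because our objects are representations of `Γ_K`.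
-/

noncomputable section

open Field

namespace Literature.NumberTheory.GaloisRepresentations

universe u v

/-! ### Involutions of determinant one in rank two -/

section SL2Involution

variable {A : Type v} [CommRing A] [IsDomain A]

/-- Over an integral domain in which `2 ≠ 0`, a `2 × 2` matrix `M` with `M * M = 1` and
`det M = 1` is `1` or `-1` (the only involutions in `SL₂(A)` are `±1`): writing
`M = (a b; c d)`, `M² = 1` gives `b (a + d) = 0 = c (a + d)`, and `a + d = 0` would force
`2 = a (a + d) = 0` from `a² + b c = 1 = a d - b c`; hence `b = c = 0`, `a = d`, `a² = 1`.
Declared in the `Matrix` namespace on purpose (dot-notation on `Matrix`). [folklore] -/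
theorem _root_.Matrix.eq_one_or_eq_neg_one_of_mul_self_of_det (h2 : (2 : A) ≠ 0)
    {M : Matrix (Fin 2) (Fin 2) A} (hM : M * M = 1) (hdet : M.det = 1) : M = 1 ∨ M = -1 := by
  have e := fun i j => congrFun (congrFun hM i) j
  simp only [Matrix.mul_apply, Fin.sum_univ_two, Matrix.one_apply] at e
  have e00 := e 0 0
  have e01 := e 0 1
  have e10 := e 1 0
  have e11 := e 1 1
  simp only [Fin.isValue, ↓reduceIte, one_ne_zero, zero_ne_one] at e00 e01 e10 e11
  rw [Matrix.det_fin_two] at hdet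
  -- the trace is nonzero
  have htr : M 0 0 + M 1 1 ≠ 0 := by
    intro h0
    apply h2
    linear_combination (M 0 0) * h0 - e00 - hdet
  have hb : M 0 1 = 0 := by
    have : M 0 1 * (M 0 0 + M 1 1) = 0 := by linear_combination e01
    exact (mul_eq_zero.mp this).resolve_right htr
  have hc : M 1 0 = 0 := by
    have : M 1 0 * (M 0 0 + M 1 1) = 0 := by linear_combination e10
    exact (mul_eq_zero.mp this).resolve_right htr
  have had : M 0 0 = M 1 1 := by
    have : (M 0 0 - M 1 1) * (M 0 0 + M 1 1) = 0 := by
      linear_combination e00 - e11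
    exact sub_eq_zero.mp ((mul_eq_zero.mp this).resolve_right htr)
  have ha : M 0 0 = 1 ∨ M 0 0 = -1 := by
    have : (M 0 0 - 1) * (M 0 0 + 1) = 0 := by
      linear_combination e00 - M 1 0 * hb
    rcases mul_eq_zero.mp this with h | h
    · exact Or.inl (sub_eq_zero.mp h)
    · exact Or.inr (eq_neg_of_add_eq_zero_left h)
  rcases ha with ha | ha
  · left
    ext i j
    fin_cases i <;> fin_cases j <;> simp [ha, hb, hc, ← had]
  · right
    ext i j
    fin_cases i <;> fin_cases j <;> simp [ha, hb, hc, ← had]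

end SL2Involution

/-! ### Even representations -/

section Even

variable {K : Type u} [Field K] {A : Type v} [CommRing A] [TopologicalSpace A] {n : ℕ}

/-- A framed Galois representation `ρ : Γ_K → GL_n(A)` is **even** (totally even) if
`det ρ(c) = 1` for every complex conjugation `c ∈ Γ_K` attached to every real embedding
`φ : K →+* ℝ` (`Literature.NumberTheory.GaloisRepresentations.IsComplexConjugation φ c`;
`Matrix.GeneralLinearGroup.det`).  Dual to `FramedGaloisRep.IsOdd` (`det ρ(c) = -1`); vacuous for
totally complex `K`, as in the literature.  Only the framed form is provided, as for `IsOdd`.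
Ref: Serre, Duke Math. J. 54 (1987), §1.1; Booker, Ann. of Math. 158 (2003), p. 1090 ("ρ is even
(meaning det(ρ)(c) = 1, where c denotes complex conjugation)"). [cite: Booker2003, p. 1090] -/
def FramedGaloisRep.IsEven (ρ : FramedGaloisRep K A n) : Prop :=
  ∀ (φ : K →+* ℝ) (c : absoluteGaloisGroup K), IsComplexConjugation φ c →
    Matrix.GeneralLinearGroup.det (ρ c) = 1

/-- Unfolding lemma for `IsEven` in terms of the determinant character
`Literature.NumberTheory.GaloisRepresentations.FramedRep.det`. [folklore] -/
lemma FramedGaloisRep.isEven_iff [IsTopologicalRing A] (ρ : FramedGaloisRep K A n) :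
    ρ.IsEven ↔ ∀ (φ : K →+* ℝ) (c : absoluteGaloisGroup K), IsComplexConjugation φ c →
      FramedRep.det ρ c = 1 :=
  Iff.rfl

/-- The trivial rank-`n` representation is even. [folklore] -/
lemma FramedGaloisRep.isEven_one : (1 : FramedGaloisRep K A n).IsEven := by
  intro φ c _
  rw [ContinuousMonoidHom.coe_one, Pi.one_apply, map_one]

/-- Without real embeddings (e.g. `K` totally complex) every representation is (vacuously) even.
[folklore] -/
lemma FramedGaloisRep.isEven_of_isEmpty [IsEmpty (K →+* ℝ)] (ρ : FramedGaloisRep K A n) :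
    ρ.IsEven :=
  fun φ => isEmptyElim φ

/-- For every complex conjugation `c`, `det ρ(c)² = 1` (since `c² = 1`,
`IsComplexConjugation.sq_eq_one`): the determinant at `c` is a sign whatever the parity.
[folklore] -/
lemma FramedGaloisRep.det_sq_eq_one_of_isComplexConjugation (ρ : FramedGaloisRep K A n)
    {φ : K →+* ℝ} {c : absoluteGaloisGroup K} (hc : IsComplexConjugation φ c) :
    Matrix.GeneralLinearGroup.det (ρ c) ^ 2 = 1 := by
  rw [← map_pow, ← map_pow, hc.sq_eq_one, map_one, map_one]

/-- Even and odd are mutually exclusive as soon as `K` has a real embedding `φ` and `2 ≠ 0` in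
`A` (a complex conjugation for `φ` exists, `exists_isComplexConjugation`, and `1 ≠ -1` in `A`).
[folklore] -/
lemma FramedGaloisRep.IsEven.not_isOdd {ρ : FramedGaloisRep K A n} (h : ρ.IsEven) (φ : K →+* ℝ)
    (h2 : (2 : A) ≠ 0) : ¬ ρ.IsOdd := by
  intro hodd
  obtain ⟨c, hc⟩ := exists_isComplexConjugation φ
  have h1 : ((1 : Aˣ) : A) = ((-1 : Aˣ) : A) :=
    congrArg Units.val ((h φ c hc).symm.trans (hodd φ c hc))
  rw [Units.val_one, Units.val_neg, Units.val_one] at h1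
  exact h2 (by linear_combination h1)

/-- The dual of an even framed Galois representation is even:
`det ρ^∨(c) = (det ρ(c))⁻¹ = 1` (`det_glTransposeInv`). [folklore] -/
theorem FramedGaloisRep.IsEven.dual {ρ : FramedGaloisRep K A n} (h : ρ.IsEven) :
    FramedGaloisRep.IsEven (FramedRep.dual ρ) := by
  intro φ c hc
  change Matrix.GeneralLinearGroup.det (glTransposeInv (Fin n) A (ρ c)) = 1
  rw [det_glTransposeInv, h φ c hc, inv_one]

/-- Evenness is invariant under change of frame `ρ ↦ P ρ P⁻¹` (`FramedRep.conj`): the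
determinant is conjugation invariant. [folklore] -/
theorem FramedGaloisRep.isEven_conj_iff [IsTopologicalRing A] (P : GL (Fin n) A)
    (ρ : FramedGaloisRep K A n) : FramedGaloisRep.IsEven (FramedRep.conj P ρ) ↔ ρ.IsEven := by
  refine forall₃_congr fun φ c _ => ?_
  rw [FramedRep.conj_apply, map_mul, map_mul, map_inv, mul_right_comm, mul_inv_cancel, one_mul]

/-- **Evenness is an invariant of the isomorphism class**: if the continuous representations
underlying `ρ, ρ'` are equivalent and `ρ` is even, so is `ρ'`
(`FramedRep.exists_eq_conj_of_equiv`, `isEven_conj_iff`). [folklore] -/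
theorem FramedGaloisRep.isEven_of_equiv [IsTopologicalRing A] {ρ ρ' : FramedGaloisRep K A n}
    (e : ContinuousRep.Equiv ρ.toGaloisRep ρ'.toGaloisRep) (h : ρ.IsEven) : ρ'.IsEven := by
  obtain ⟨P, rfl⟩ := FramedRep.exists_eq_conj_of_equiv ρ ρ' e
  exact (isEven_conj_iff P ρ).mpr h

end Even

/-! ### Rank two: even means complex conjugations act by `±1` -/

section RankTwo

variable {K : Type u} [Field K] {A : Type v} [CommRing A] [IsDomain A] [TopologicalSpace A]

/-- In rank `2` over an integral domain `A` with `2 ≠ 0`, a framed Galois representation is even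
iff every complex conjugation `c` acts by the scalar `1` or `-1`: `ρ(c)` is an involution
(`IsComplexConjugation.sq_eq_one`) of determinant `1`, and the only such `2 × 2` matrices are
`±1` (`Matrix.eq_one_or_eq_neg_one_of_mul_self_of_det`).  In particular for an even
`ρ : Γ_ℚ → GL₂(ℂ)` the image of complex conjugation is central (no irreducibility needed).
[folklore] -/
theorem FramedGaloisRep.isEven_iff_eq_one_or_eq_neg_one (h2 : (2 : A) ≠ 0)
    (ρ : FramedGaloisRep K A 2) :
    ρ.IsEven ↔ ∀ (φ : K →+* ℝ) (c : absoluteGaloisGroup K), IsComplexConjugation φ c →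
      ρ c = 1 ∨ ρ c = -1 := by
  refine forall₃_congr fun φ c hc => ⟨fun h => ?_, fun h => ?_⟩
  · have hsq : ((ρ c : GL (Fin 2) A) : Matrix (Fin 2) (Fin 2) A) * (ρ c : GL (Fin 2) A) = 1 := by
      rw [← Units.val_mul, ← map_mul, ← sq, hc.sq_eq_one, map_one, Units.val_one]
    have hdet : ((ρ c : GL (Fin 2) A) : Matrix (Fin 2) (Fin 2) A).det = 1 := by
      rw [← Matrix.GeneralLinearGroup.val_det_apply, h, Units.val_one]
    rcases Matrix.eq_one_or_eq_neg_one_of_mul_self_of_det h2 hsq hdet with h1 | h1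
    · exact Or.inl (Units.ext h1)
    · exact Or.inr (Units.ext (by rw [h1, Units.val_neg, Units.val_one]))
  · rcases h with h | h
    · rw [h, map_one]
    · apply Units.ext
      rw [Matrix.GeneralLinearGroup.val_det_apply, h, Units.val_neg, Units.val_one,
        Matrix.det_neg, Matrix.det_one, mul_one, Fintype.card_fin, Units.val_one]
      norm_num

end RankTwo

end Literature.NumberTheory.GaloisRepresentations
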